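import Literature.MathematicalPhysics.KineticTheory.TaggedSphereDomainInputs
import Literature.MathematicalPhysics.KineticTheory.HierarchyDuhamelSeriesOn
import Literature.MathematicalPhysics.KineticTheory.TaggedSphereComparisonTuning
import Literature.MathematicalPhysics.KineticTheory.TaggedSphereLinearBoltzmannRate
import Mathlib.Analysis.SpecialFunctions.Pow.Asymptotics
import HarnessLib

/-!
# BGSR Theorem 2.2 (2.9) reduced to three inputs on the hard-sphere dynamics (Prop. 5.8 assembled)
(Bodineau–Gallagher–Saint-Raymond, Invent. Math. 203 (2016) = arXiv:1305.3397v2, §5.3.4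
Proposition 5.8 and the proof of Theorem 2.2, p. 21 of the held text; trunk T-KINETIC, topic
MathematicalPhysics/KineticTheory; the LAST glue step of the bottom-up plan towards the named fact
`bgsr_linearBoltzmannApprox` (`TaggedSphereDiffusion`) recorded in `TaggedSphereLinearBoltzmannRate`.)

BGSR Proposition 5.8 (p. 21): *"For parameters satisfying (5.1) and such that
`αt ≪ (log log N)^{(A-1)/A}` and `K ≤ log log N/(2 log A)` then as `N` goes to infinity
`‖f_N^{(1,K)} - g_α^{(1,K)}‖_{L^∞([0,t] × T^d × ℝ^d)} ≤ ‖ρ⁰‖_∞ ε^{(d-1)/(d+1)} exp(C (log N)^{1/2}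
log log N)`"*, and the proof of Theorem 2.2: *"Propositions 4.3 and 5.8 imply that with the
scaling (5.27) `‖f_N^{(1)} - g_α‖ ≤ C(γ^A + C₀ ε^{(d-1)/(d+1)} exp(C(log N)^{1/2} log log N))
‖ρ⁰‖_∞`"* — the pruned comparison (H) of `TaggedSphereLinearBoltzmannRate`, whose glue
`bgsr_linearBoltzmannApprox_of_prunedComparison_pow` turns it into (2.9).

This file PROVES (H), with the honest exponent `(d-1)/(q+1) = 1/6` (`q = 6d - 7`; see
`GoodConfigurationsMeasure` for why the rate differs from the printed one), from the assembled
comparison `ae_abs_bgsrMarginalFamily_sub_bgsrHierarchyFamily_le` (`TaggedSphereMainTermComparison`: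
Props. 4.3, 5.3–5.7 of both sides) and the tuning of `TaggedSphereComparisonTuning`, CONDITIONALLY
on three inputs on the hard-sphere dynamics that the tree does not (yet) prove and that are
hypotheses here, not named facts:

* (S) the iterated Duhamel formula up to null sets for the marginals of the transported BGSR datum
  along the regularised flows (Spohn 2006 Thm 11; the hypothesis `hS` of
  `bgsrMarginal_ae_abs_sub_truncSepMain_le`, `HardSphereHierarchyModel`);
* (R) the Duhamel terms of the hard-sphere model respect Lebesgue-null sets
  (`HierarchyModel.RespectsAE`, ibid.);
* (Reg) almost every one-particle configuration is regular to all depths (`bgsrRegular`,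
  `PseudoTrajectoryCoupling`: the a.e. well-definedness of the BBGKY pseudo-trajectories along the
  regularised flow, Simonella 2014, BGSR p. 15).

Main results: `bgsr_prunedComparison_of_inputs` ((H) with `q = 6d - 7`) and
`bgsr_linearBoltzmannApprox_of_inputs` (BGSR Thm 2.2 (2.9), the named fact, from (S), (R), (Reg)).

**Correction of the inputs (`TaggedSphereDomainInputs`).** In the form first stated here — and still
carried, verbatim, by `bgsr_prunedComparison_of_inputs` / `bgsr_linearBoltzmannApprox_of_inputs`,
kept for their users — the input (R) reads `(hsHierarchyModel hε hε' (N+1)).RespectsAE (fun _ => volume)`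
for ALL nice families, which is false for the hard-sphere model (the regularised flows are the
identity off the hard-sphere domain, where the order-one Duhamel term then reads its datum on the
null contact set; see the module docstring of `TaggedSphereDomainInputs` for the counterexample),
and (S) was quantified over every real `β` and every function `ρ⁰`. The theorem to USE is
`bgsr_linearBoltzmannApprox_of_domainInputs`, whose three hypotheses are the inputs in their
corrected, provable form: (S) for `β > 0`, continuous probability densities `0 ≤ ρ⁰ ≤ R`, in the
regime `N(2ε)^d ≤ 1/2`, at times `t ≥ 0`; (R) for nice families SUPPORTED IN THE HARD-SPHERE
DOMAINS (`HierarchyModel.RespectsAEOn … (fun _ => volume) (fun k => hardSphereDomain … k ε)`,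
`HierarchyDuhamelSeriesOn`); (Reg) for physical diameters `0 < ε < 1/2`. The tuning itself
(`bgsr_prunedComparison_of_domInputs`) is carried out once, for the inputs stated with the
measures `hsDomMeasure ε` of `TaggedSphereDomainInputs`, of which both forms are corollaries.

## References

* T. Bodineau, I. Gallagher, L. Saint-Raymond, *The Brownian motion as the limit of a
  deterministic system of hard-spheres*, Invent. Math. 203 (2016) 493–553 = arXiv:1305.3397v2,
  Thm 2.2 (2.9) p. 7; §5.3.4 Prop. 5.8 and proof of Thm 2.2, p. 21.
-/

open MeasureTheory Metric Real Set Filter Function Asymptotics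
open scoped InnerProductSpace ENNReal Nat Topology
open Literature.Analysis.FluidPDE (Config configEnergy Geometry GCState hardSphereDomain freeFlight
  bgsrGoodConfigs HardSphereFlow duhamelTerm)
open Literature.Analysis.FunctionSpaces (maxwellianBeta)

namespace Literature.MathematicalPhysics.KineticTheory

noncomputable section

open Literature.Analysis.FunctionSpaces.Torus Literature.Analysis.FluidPDE.Torus

section Kinetic

variable {d : Type*} [Fintype d]

/-! ## §1. Translations between the objects of the assembly and those of the fact -/

omit [Fintype d] in
/-- A one-particle configuration is the constant tuple of its only particle. [folklore] -/
theorem config_one_eq_const {X : Type*} (Z : Config 1 d X) : Z = fun _ => Z 0 := by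
  funext i
  rw [Subsingleton.elim i 0]

/-- Transfer of an almost-everywhere statement from `Config 1` to the one-particle phase space
`T^d × ℝ^d` (the measure-preserving `MeasurableEquiv.funUnique`). [folklore] -/
theorem ae_prod_of_ae_config_one {P : UnitAddTorus d × EuclideanSpace ℝ d → Prop}
    (h : ∀ᵐ Z : Config 1 d (UnitAddTorus d), P (Z 0)) :
    ∀ᵐ z : UnitAddTorus d × EuclideanSpace ℝ d, P z := by
  have hmp := (volume_preserving_funUnique (Fin 1) (UnitAddTorus d × EuclideanSpace ℝ d)).symm
  have h' := hmp.quasiMeasurePreserving.ae h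
  simpa using h'

/-- At level `1` BGSR's factorised family is `φ(t, x, v) M_β(v)`. [folklore] -/
theorem bgsrHierarchyFamily_one_const (β : ℝ) (phi : ℝ → UnitAddTorus d → EuclideanSpace ℝ d → ℝ) (t : ℝ)
    (z : UnitAddTorus d × EuclideanSpace ℝ d) :
    bgsrHierarchyFamily β phi 1 t (fun _ : Fin 1 => z) = phi t z.1 z.2 * maxwellianBeta β z.2 := by
  rw [bgsrHierarchyFamily_succ]
  simp [maxwellianTensor, Literature.Analysis.FluidPDE.tensorPow]

/-- The pruning constant of the hard-sphere model: `c_R = (4√2 C_d √2^d / √β^{d+1}) · M ε^{d-1}`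
for `M` spheres. [folklore] -/
theorem pruneConst_hsHierarchyModel {ε : ℝ} (hε : 0 < ε) (hε' : ε < 2⁻¹) (M : ℕ) (b : ℝ) :
    (hsHierarchyModel (d := d) hε hε' M).pruneConst b =
      (4 * sqrt 2 * ((∫ u : EuclideanSpace ℝ d, (1 + ‖u‖) * exp (-(1 / 2) * ‖u‖ ^ 2)) *
          (sphereMeasure (E := EuclideanSpace ℝ d)).real univ) * sqrt 2 ^ Fintype.card d /
          sqrt b ^ (Fintype.card d + 1)) *
        (M * ε ^ (Fintype.card d - 1)) := by
  show 4 * sqrt 2 * ((M * ε ^ (Fintype.card d - 1)) *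
      ((∫ u : EuclideanSpace ℝ d, (1 + ‖u‖) * exp (-(1 / 2) * ‖u‖ ^ 2)) *
        (sphereMeasure (E := EuclideanSpace ℝ d)).real univ)) * sqrt 2 ^ Fintype.card d /
      sqrt b ^ (Fintype.card d + 1) = _
  ring

/-! ## §2. Largeness of `N` -/

omit [Fintype d] in
/-- `(log(N+1))^r (N+1)^{-s} → 0` for `s > 0`. [folklore] -/
theorem tendsto_log_rpow_mul_rpow_neg (r : ℝ) {s : ℝ} (hs : 0 < s) :
    Tendsto (fun N : ℕ => Real.log ((N : ℝ) + 1) ^ r * ((N : ℝ) + 1) ^ (-s)) atTop (𝓝 0) := by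
  have h1 : Tendsto (fun N : ℕ => (N : ℝ) + 1) atTop atTop :=
    tendsto_atTop_add_const_right atTop (1 : ℝ) tendsto_natCast_atTop_atTop
  have h2 := (isLittleO_log_rpow_rpow_atTop r hs).tendsto_div_nhds_zero
  have h3 := h2.comp h1
  refine h3.congr' ?_
  filter_upwards [Filter.eventually_ge_atTop 0] with N _
  have hN : (0 : ℝ) < (N : ℝ) + 1 := by positivity
  simp only [Function.comp_apply]
  rw [div_eq_mul_inv, ← rpow_neg hN.le]

omit [Fintype d] in
/-- The threshold `N₁`: beyond it `N + 1 ≥ e^e` (so `log N ≥ 1`, `log log N ≥ 1`) and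
`(log N)² N^{-p} ≤ η₀`. [folklore] -/
theorem exists_bgsr_threshold {η₀ p : ℝ} (hη₀ : 0 < η₀) (hp : 0 < p) :
    ∃ N₁ : ℕ, ∀ N : ℕ, N₁ ≤ N → exp (exp 1) ≤ (N : ℝ) + 1 ∧
      Real.log ((N : ℝ) + 1) ^ 2 * ((N : ℝ) + 1) ^ (-p) ≤ η₀ := by
  have h1 : ∀ᶠ N : ℕ in atTop, Real.log ((N : ℝ) + 1) ^ (2 : ℝ) * ((N : ℝ) + 1) ^ (-p) ≤ η₀ :=
    (tendsto_log_rpow_mul_rpow_neg 2 hp).eventually (Iic_mem_nhds hη₀)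
  have h2 : ∀ᶠ N : ℕ in atTop, exp (exp 1) ≤ (N : ℝ) + 1 :=
    (tendsto_atTop_add_const_right atTop (1 : ℝ) tendsto_natCast_atTop_atTop).eventually_ge_atTop _
  obtain ⟨N₁, hN₁⟩ := eventually_atTop.1 (h2.and h1)
  refine ⟨N₁, fun N hN => ?_⟩
  obtain ⟨ha, hb⟩ := hN₁ N hN
  exact ⟨ha, by rwa [Real.rpow_two] at hb⟩

/-! ## §3. The real bookkeeping of the final bound -/

omit [Fintype d] in
/-- **Bookkeeping of the proof of BGSR Thm 2.2 from Prop. 5.8** (p. 21): the eight error terms of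
`ae_abs_bgsrMarginalFamily_sub_bgsrHierarchyFamily_le`, under the tuning of §4 below, expressed
through the single large quantity `X = exp(√(log N) log log N) ≥ 1` (which dominates `log N`,
`log log N`, `A^K`, `e^{A^K}`, `α`, `t`) and the small one `s = ε^{1/6}` (which dominates `ε`,
`δ = s²`, `e^{-βE²/4} = ε` and the bad-set measure), sum to at most `C₁ (γ^A + s X^{10d+15})` with
`C₁ = max (10 d + 15) (max R 1 · C · (20 + 2^{d+1} + 48 C c_P + 24 c_E c_M))`, `C = max 1 (4 (β/2π)^{d/2})`.
[cite: BodineauGallagherSaintRaymondInvent2016, §5.3.4, proof of Thm 2.2, p. 21] -/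
theorem bgsr_final_bookkeeping {n A₀ K L N : ℕ} (hn : 2 ≤ n) (hA₀ : 1 ≤ A₀)
    {R mC cR₁ cR₁' cR₂ cR₂' α ε s h δ E mBad γ γA X cP cE cM β : ℝ}
    (hR : 0 ≤ R) (hmC : 0 ≤ mC) (hX : 1 ≤ X) (hs0 : 0 ≤ s) (hs1 : s ≤ 1)
    (hγ0 : 0 ≤ γ) (hγA : γ ^ A₀ ≤ γA)
    (hEs : exp (-(β * E ^ 2 / 4)) ≤ s) (hE0 : 0 ≤ E) (hcE : 0 ≤ cE) (hEX : E ≤ cE * X)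
    (hP : (A₀ : ℝ) ^ K ≤ X) (hexpP : exp ((A₀ : ℝ) ^ K) ≤ X)
    (hδ0 : 0 ≤ δ) (hδs : δ ≤ s) (hh0 : 0 ≤ h)
    (hcR₁ : 0 ≤ cR₁) (hcR₁' : 0 ≤ cR₁') (hcR₂ : 0 ≤ cR₂) (hcR₂' : 0 ≤ cR₂') (hcP : 0 ≤ cP)
    (hcR₁X : cR₁ ≤ cP * X) (hcR₂X : cR₂ ≤ cP * X)
    (hu₁ : max 1 (4 * mC) * cR₁ * h ≤ 1) (hu₁' : max 1 (4 * mC) * cR₁' * h ≤ 1)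
    (hu₂ : max 1 (4 * mC) * cR₂ * h ≤ 1) (hu₂' : max 1 (4 * mC) * cR₂' * h ≤ 1)
    (hu₃ : (6 * cR₂ + 12 * α) * max 1 (4 * mC) * h ≤ 6)
    (hα1 : 1 < α) (hαX : α ≤ X) (hε0 : 0 < ε) (hεs : ε ≤ s) (hNα : ((N : ℝ) + 1) * ε ^ (n - 1) = α)
    (hL : (L : ℝ) ≤ 2 * X) (hmBad0 : 0 ≤ mBad) (hcM : 0 ≤ cM) (hmBad : mBad ≤ s * (cM * X ^ (10 * n + 6))) :
    (4 * γ ^ A₀ * R * max 1 (2 * mC) +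
          R * exp (-(β * E ^ 2 / 4)) * max 1 (2 * mC) *
            exp (6 * (max 1 (2 * mC) *
              cR₁' * h) * (A₀ : ℝ) ^ K) +
          12 * R * max 1 (2 * mC) *
            (max 1 (2 * mC) * cR₁ * δ) *
            (A₀ : ℝ) ^ (2 * K) *
            exp (12 * (max 1 (2 * mC) *
              cR₁ * h) * (A₀ : ℝ) ^ K)) +
        12 * (2 * R) * max 1 (2 * mC) *
          (max 1 (2 * mC) * cR₁ * δ) *
          (A₀ : ℝ) ^ (2 * K) *
          exp (12 * (max 1 (2 * mC) * cR₁ * h) *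
            (A₀ : ℝ) ^ K) +
        max 1 (4 * mC) *
          (2 * R * (N + 1) * (2 * ε) ^ n +
            6 * max R 1 * (A₀ : ℝ) ^ K * ((L : ℝ) * ε ^ (n - 1) / α + 4 * E * mBad)) *
          exp ((6 * cR₂ +
            12 * α) * max 1 (4 * mC) * h * (A₀ : ℝ) ^ K) +
        (2 * γ ^ A₀ * max R 1 * max 1 (mC) +
          max R 1 * exp (-(β * E ^ 2 / 4)) * max 1 (mC) *
            exp (6 * (max 1 (mC) *
              cR₂' * h) * (A₀ : ℝ) ^ K) +
          12 * max R 1 * max 1 (mC) *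
            (max 1 (mC) *
              cR₂ * δ) *
            (A₀ : ℝ) ^ (2 * K) *
            exp (12 * (max 1 (mC) *
              cR₂ * h) *
              (A₀ : ℝ) ^ K)) ≤
      max (10 * n + 15 : ℝ)
          (max R 1 * max 1 (4 * mC) * (20 + 2 ^ (n + 1) + 48 * max 1 (4 * mC) * cP + 24 * cE * cM)) *
        (γA + s * X ^ (10 * n + 15)) := by
  -- abbreviations and signs
  set C := max 1 (4 * mC) with hC
  set C' := max 1 (2 * mC) with hC'
  set C''' := max 1 mC with hC'''
  set R' := max R 1 with hR'
  set P := (A₀ : ℝ) ^ K with hPdef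
  have hC1 : 1 ≤ C := le_max_left _ _
  have hC0 : 0 ≤ C := zero_le_one.trans hC1
  have hC'C : C' ≤ C := max_le_max le_rfl (by linarith)
  have hC'''C : C''' ≤ C := max_le_max le_rfl (by linarith)
  have hC'1 : 1 ≤ C' := le_max_left _ _
  have hC'0 : 0 ≤ C' := zero_le_one.trans hC'1
  have hC'''1 : 1 ≤ C''' := le_max_left _ _
  have hC'''0 : 0 ≤ C''' := zero_le_one.trans hC'''1
  have hRR' : R ≤ R' := le_max_left _ _
  have hR'1 : 1 ≤ R' := le_max_right _ _
  have hR'0 : 0 ≤ R' := zero_le_one.trans hR'1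
  have hP1 : 1 ≤ P := one_le_pow₀ (by exact_mod_cast hA₀)
  have hP0 : 0 ≤ P := zero_le_one.trans hP1
  have hX0 : 0 ≤ X := zero_le_one.trans hX
  have hγA0 : 0 ≤ γA := (pow_nonneg hγ0 _).trans hγA
  have hε1 : ε ≤ 1 := hεs.trans hs1
  have hXp : ∀ {a b : ℕ}, a ≤ b → X ^ a ≤ X ^ b := fun hab => pow_le_pow_right₀ hX hab
  have hX1p : ∀ (a : ℕ), 1 ≤ X ^ a := fun a => one_le_pow₀ hX
  -- the square of `P`
  have hP2 : (A₀ : ℝ) ^ (2 * K) ≤ X ^ 2 := by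
    rw [mul_comm, pow_mul]
    exact pow_le_pow_left₀ hP0 hP 2
  -- exponentials
  have hexp_le : ∀ {y : ℝ} (k : ℕ), y ≤ k * P → exp y ≤ X ^ k := by
    intro y k hy
    calc exp y ≤ exp (k * P) := exp_le_exp.2 hy
      _ = exp P ^ k := Real.exp_nat_mul P k ▸ rfl
      _ ≤ X ^ k := pow_le_pow_left₀ (exp_pos _).le hexpP k
  have hy₁' : C' * cR₁' * h ≤ 1 :=
    (mul_le_mul_of_nonneg_right (mul_le_mul_of_nonneg_right hC'C hcR₁') hh0).trans hu₁'
  have hy₁ : C' * cR₁ * h ≤ 1 :=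
    (mul_le_mul_of_nonneg_right (mul_le_mul_of_nonneg_right hC'C hcR₁) hh0).trans hu₁
  have hy₂' : C''' * cR₂' * h ≤ 1 :=
    (mul_le_mul_of_nonneg_right (mul_le_mul_of_nonneg_right hC'''C hcR₂') hh0).trans hu₂'
  have hy₂ : C''' * cR₂ * h ≤ 1 :=
    (mul_le_mul_of_nonneg_right (mul_le_mul_of_nonneg_right hC'''C hcR₂) hh0).trans hu₂
  have he2 : exp (6 * (C' * cR₁' * h) * P) ≤ X ^ 6 :=
    hexp_le 6 (by push_cast; exact mul_le_mul_of_nonneg_right (mul_le_of_le_one_right (by norm_num) hy₁') hP0)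
  have he3 : exp (12 * (C' * cR₁ * h) * P) ≤ X ^ 12 :=
    hexp_le 12 (by push_cast; exact mul_le_mul_of_nonneg_right (mul_le_of_le_one_right (by norm_num) hy₁) hP0)
  have he5 : exp ((6 * cR₂ + 12 * α) * C * h * P) ≤ X ^ 6 :=
    hexp_le 6 (by push_cast; exact mul_le_mul_of_nonneg_right hu₃ hP0)
  have he7 : exp (6 * (C''' * cR₂' * h) * P) ≤ X ^ 6 :=
    hexp_le 6 (by push_cast; exact mul_le_mul_of_nonneg_right (mul_le_of_le_one_right (by norm_num) hy₂') hP0)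
  have he8 : exp (12 * (C''' * cR₂ * h) * P) ≤ X ^ 12 :=
    hexp_le 12 (by push_cast; exact mul_le_mul_of_nonneg_right (mul_le_of_le_one_right (by norm_num) hy₂) hP0)
  have hEε : exp (-(β * E ^ 2 / 4)) ≤ s := hEs
  -- the eight terms
  have hT1 : 4 * γ ^ A₀ * R * C' ≤ 4 * R' * C * γA := by
    calc 4 * γ ^ A₀ * R * C' ≤ 4 * γA * R' * C := by gcongr
      _ = 4 * R' * C * γA := by ring
  have hT2 : R * exp (-(β * E ^ 2 / 4)) * C' * exp (6 * (C' * cR₁' * h) * P) ≤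
      R' * C * (s * X ^ (10 * n + 15)) := by
    calc R * exp (-(β * E ^ 2 / 4)) * C' * exp (6 * (C' * cR₁' * h) * P) ≤ R' * s * C * X ^ 6 := by
          gcongr
      _ ≤ R' * s * C * X ^ (10 * n + 15) := by gcongr R' * s * C * X ^ ?_; omega
      _ = R' * C * (s * X ^ (10 * n + 15)) := by ring
  have hδX : ∀ {c cR : ℝ}, 0 ≤ c → c ≤ C → 0 ≤ cR → cR ≤ cP * X → c * cR * δ ≤ C * (cP * X) * s := by
    intro c cR hc0 hcC hcR0 hcRX
    gcongr
  have hT3 : 12 * R * C' * (C' * cR₁ * δ) * (A₀ : ℝ) ^ (2 * K) * exp (12 * (C' * cR₁ * h) * P) ≤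
      12 * R' * C * (C * cP) * (s * X ^ (10 * n + 15)) := by
    calc 12 * R * C' * (C' * cR₁ * δ) * (A₀ : ℝ) ^ (2 * K) * exp (12 * (C' * cR₁ * h) * P)
        ≤ 12 * R' * C * (C * (cP * X) * s) * X ^ 2 * X ^ 12 := by
          gcongr 12 * ?_ * ?_ * ?_ * ?_ * ?_
          exact hδX hC'0 hC'C hcR₁ hcR₁X
      _ = 12 * R' * C * (C * cP) * (s * X ^ 15) := by ring
      _ ≤ 12 * R' * C * (C * cP) * (s * X ^ (10 * n + 15)) := by
          gcongr 12 * R' * C * (C * cP) * (s * X ^ ?_)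
          omega
  have hT4 : 12 * (2 * R) * C' * (C' * cR₁ * δ) * (A₀ : ℝ) ^ (2 * K) * exp (12 * (C' * cR₁ * h) * P) ≤
      24 * R' * C * (C * cP) * (s * X ^ (10 * n + 15)) := by
    calc 12 * (2 * R) * C' * (C' * cR₁ * δ) * (A₀ : ℝ) ^ (2 * K) * exp (12 * (C' * cR₁ * h) * P)
        = 2 * (12 * R * C' * (C' * cR₁ * δ) * (A₀ : ℝ) ^ (2 * K) * exp (12 * (C' * cR₁ * h) * P)) := by ring
      _ ≤ 2 * (12 * R' * C * (C * cP) * (s * X ^ (10 * n + 15))) := by gcongr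
      _ = _ := by ring
  -- the fifth term
  have hn1 : 1 ≤ n - 1 := by omega
  have hNε : ((N : ℝ) + 1) * (2 * ε) ^ n ≤ 2 ^ n * X * s := by
    have h1 : ((N : ℝ) + 1) * (2 * ε) ^ n = 2 ^ n * α * ε := by
      have h2 : (2 * ε) ^ n = 2 ^ n * (ε ^ (n - 1) * ε) := by
        rw [mul_pow, ← pow_succ, Nat.sub_add_cancel (by omega : 1 ≤ n)]
      rw [h2, ← hNα]
      ring
    rw [h1]
    gcongr
  have hLε : (L : ℝ) * ε ^ (n - 1) / α ≤ 2 * X * s := by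
    have h1 : (L : ℝ) * ε ^ (n - 1) / α ≤ (L : ℝ) * ε ^ (n - 1) :=
      div_le_self (by positivity) hα1.le
    have h2 : ε ^ (n - 1) ≤ ε := by
      calc ε ^ (n - 1) ≤ ε ^ 1 := pow_le_pow_of_le_one hε0.le hε1 hn1
        _ = ε := pow_one ε
    calc (L : ℝ) * ε ^ (n - 1) / α ≤ (L : ℝ) * ε ^ (n - 1) := h1
      _ ≤ 2 * X * s := by gcongr; exact h2.trans hεs
  have hEm : 4 * E * mBad ≤ 4 * (cE * X) * (s * (cM * X ^ (10 * n + 6))) := by gcongr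
  have hT5 : C * (2 * R * (N + 1) * (2 * ε) ^ n + 6 * R' * P * ((L : ℝ) * ε ^ (n - 1) / α + 4 * E * mBad)) *
        exp ((6 * cR₂ + 12 * α) * C * h * P) ≤
      R' * C * (2 ^ (n + 1) + 12 + 24 * cE * cM) * (s * X ^ (10 * n + 15)) := by
    have hin : 2 * R * (N + 1) * (2 * ε) ^ n + 6 * R' * P * ((L : ℝ) * ε ^ (n - 1) / α + 4 * E * mBad) ≤
        2 * R' * (2 ^ n * X * s) + 6 * R' * X * (2 * X * s + 4 * (cE * X) * (s * (cM * X ^ (10 * n + 6)))) := by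
      have h1 : 2 * R * (N + 1) * (2 * ε) ^ n ≤ 2 * R' * (2 ^ n * X * s) := by
        rw [mul_assoc (2 * R)]
        gcongr
      have h2 : 6 * R' * P * ((L : ℝ) * ε ^ (n - 1) / α + 4 * E * mBad) ≤
          6 * R' * X * (2 * X * s + 4 * (cE * X) * (s * (cM * X ^ (10 * n + 6)))) := by
        have h3 : 0 ≤ (L : ℝ) * ε ^ (n - 1) / α + 4 * E * mBad := by positivity
        gcongr 6 * R' * ?_ * ?_
        exact add_le_add hLε hEm
      exact add_le_add h1 h2
    have hin0 : 0 ≤ 2 * R * (N + 1) * (2 * ε) ^ n + 6 * R' * P * ((L : ℝ) * ε ^ (n - 1) / α + 4 * E * mBad) := by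
      positivity
    calc C * (2 * R * (N + 1) * (2 * ε) ^ n + 6 * R' * P * ((L : ℝ) * ε ^ (n - 1) / α + 4 * E * mBad)) *
          exp ((6 * cR₂ + 12 * α) * C * h * P)
        ≤ C * (2 * R' * (2 ^ n * X * s) +
            6 * R' * X * (2 * X * s + 4 * (cE * X) * (s * (cM * X ^ (10 * n + 6))))) * X ^ 6 := by
          gcongr
      _ = R' * C * s * (2 ^ (n + 1) * X ^ 7 + 12 * X ^ 8 + 24 * cE * cM * X ^ (10 * n + 14)) := by ring
      _ ≤ R' * C * s * (2 ^ (n + 1) * X ^ (10 * n + 15) + 12 * X ^ (10 * n + 15) +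
            24 * cE * cM * X ^ (10 * n + 15)) := by
          gcongr R' * C * s * (2 ^ (n + 1) * X ^ ?_ + 12 * X ^ ?_ + 24 * cE * cM * X ^ ?_) <;> omega
      _ = R' * C * (2 ^ (n + 1) + 12 + 24 * cE * cM) * (s * X ^ (10 * n + 15)) := by ring
  have hT6 : 2 * γ ^ A₀ * R' * C''' ≤ 2 * R' * C * γA := by
    calc 2 * γ ^ A₀ * R' * C''' ≤ 2 * γA * R' * C := by gcongr
      _ = 2 * R' * C * γA := by ring
  have hT7 : R' * exp (-(β * E ^ 2 / 4)) * C''' * exp (6 * (C''' * cR₂' * h) * P) ≤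
      R' * C * (s * X ^ (10 * n + 15)) := by
    calc R' * exp (-(β * E ^ 2 / 4)) * C''' * exp (6 * (C''' * cR₂' * h) * P) ≤ R' * s * C * X ^ 6 := by
          gcongr
      _ ≤ R' * s * C * X ^ (10 * n + 15) := by gcongr R' * s * C * X ^ ?_; omega
      _ = R' * C * (s * X ^ (10 * n + 15)) := by ring
  have hT8 : 12 * R' * C''' * (C''' * cR₂ * δ) * (A₀ : ℝ) ^ (2 * K) * exp (12 * (C''' * cR₂ * h) * P) ≤
      12 * R' * C * (C * cP) * (s * X ^ (10 * n + 15)) := by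
    calc 12 * R' * C''' * (C''' * cR₂ * δ) * (A₀ : ℝ) ^ (2 * K) * exp (12 * (C''' * cR₂ * h) * P)
        ≤ 12 * R' * C * (C * (cP * X) * s) * X ^ 2 * X ^ 12 := by
          gcongr 12 * ?_ * ?_ * ?_ * ?_ * ?_
          exact hδX hC'''0 hC'''C hcR₂ hcR₂X
      _ = 12 * R' * C * (C * cP) * (s * X ^ 15) := by ring
      _ ≤ 12 * R' * C * (C * cP) * (s * X ^ (10 * n + 15)) := by
          gcongr 12 * R' * C * (C * cP) * (s * X ^ ?_)
          omega
  -- summation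
  have hsum := add_le_add (add_le_add (add_le_add (add_le_add (add_le_add hT1 hT2) hT3) hT4) hT5)
    (add_le_add (add_le_add hT6 hT7) hT8)
  refine hsum.trans ?_
  have hW0 : 0 ≤ s * X ^ (10 * n + 15) := by positivity
  set W := s * X ^ (10 * n + 15) with hW
  set Cst := max (10 * n + 15 : ℝ) (R' * C * (20 + 2 ^ (n + 1) + 48 * C * cP + 24 * cE * cM)) with hCst
  have hkγ : 6 * R' * C ≤ Cst := by
    rw [hCst]
    refine le_trans ?_ (le_max_right _ _)
    have h1 : 0 ≤ 48 * C * cP := by positivity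
    have h2 : 0 ≤ 24 * cE * cM := by positivity
    have h3 : (0 : ℝ) ≤ 2 ^ (n + 1) := by positivity
    calc 6 * R' * C = R' * C * 6 := by ring
      _ ≤ R' * C * (20 + 2 ^ (n + 1) + 48 * C * cP + 24 * cE * cM) :=
          mul_le_mul_of_nonneg_left (by linarith) (mul_nonneg hR'0 hC0)
  have hks : R' * C * (14 + 2 ^ (n + 1) + 48 * C * cP + 24 * cE * cM) ≤ Cst := by
    rw [hCst]
    refine le_trans ?_ (le_max_right _ _)
    exact mul_le_mul_of_nonneg_left (by linarith) (mul_nonneg hR'0 hC0)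
  calc 4 * R' * C * γA + R' * C * W + 12 * R' * C * (C * cP) * W + 24 * R' * C * (C * cP) * W +
        R' * C * (2 ^ (n + 1) + 12 + 24 * cE * cM) * W +
        (2 * R' * C * γA + R' * C * W + 12 * R' * C * (C * cP) * W)
      = 6 * R' * C * γA + R' * C * (14 + 2 ^ (n + 1) + 48 * C * cP + 24 * cE * cM) * W := by ring
    _ ≤ Cst * γA + Cst * W := add_le_add (mul_le_mul_of_nonneg_right hkγ hγA0)
        (mul_le_mul_of_nonneg_right hks hW0)
    _ = Cst * (γA + W) := by ring

/-! ## §4. BGSR Theorem 2.2 (2.9) from the inputs (S), (R), (Reg) -/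

set_option maxHeartbeats 400000 in
/-- **BGSR Prop. 5.8 + proof of Thm 2.2, p. 21: the pruned comparison (H) from the three inputs on
the hard-sphere dynamics, stated for the measures `hsDomMeasure ε` (`TaggedSphereDomainInputs`).**
Assume (S) the iterated Duhamel formula up to `hsDomMeasure`-null sets for the marginals of the
transported BGSR data along the regularised hard-sphere flows (`β > 0`, continuous probability
densities `0 ≤ ρ⁰ ≤ R`, regime `N(2ε)^d ≤ 1/2`, times `t ≥ 0`), (R) that the Duhamel terms of the
hard-sphere models respect `hsDomMeasure`-null sets (equivalently, Lebesgue-null sets on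
domain-supported families: `respectsAE_hsDomMeasure_of_domain`), and (Reg) that for every physical
diameter `0 < ε < 1/2` and horizon almost every one-particle configuration is regular to all depths
(`bgsrRegular`) — each input being asked in dimension `d ≥ 2` only. Then the
hypothesis (H) of `bgsr_linearBoltzmannApprox_of_prunedComparison_pow` holds with `q = 6d - 7`
(rate `ε^{1/6} exp(C₁ √(log N) log log N)`): for `d ≥ 2`, `β > 0`, `A ≥ 2`, `R ≥ 0` there are
`κ₁, c₁ = 1, c₂ = 1/(2 log ⌈A⌉), C₁, N₁` such that in the regime (5.1)/(5.27) the tagged-particle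
distribution is `C₁(γ^A + ε^{1/6} e^{C₁ √(log N) log log N})`-close, a.e., to `M_β φ_α`. The
tuning (BGSR p. 21 "we choose a = ε log N/(αt), ε₀ = ε^{d/(d+1)}, δ = ε^{(d-1)/(d+1)}", here with
the honest exponents of `TaggedSphereComparisonTuning`): `h = t/K`, `E² = (4/β) log(1/ε)`,
`s = ε^{1/6}`, `ā = 3√(log N) ε`, `ε₀ = s⁴`, `δ = s²`, `λ = s`.
[cite: BodineauGallagherSaintRaymondInvent2016, §5.3.4 Prop. 5.8 and proof of Thm 2.2, p. 21] -/
theorem bgsr_prunedComparison_of_domInputs [DecidableEq d]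
    (hS : 2 ≤ Fintype.card d → ∀ (N : ℕ) (ε : ℝ) (hε : 0 < ε) (hε' : ε < 2⁻¹),
      (N : ℝ) * (2 * ε) ^ Fintype.card d ≤ 2⁻¹ →
      ∀ (β : ℝ), 0 < β → ∀ (R : ℝ) (ρ₀ : UnitAddTorus d → ℝ), Continuous ρ₀ → (∀ x, 0 ≤ ρ₀ x) →
      (∀ x, ρ₀ x ≤ R) → ∫ x, ρ₀ x = 1 → ∀ s ≤ N + 1, ∀ t : ℝ, 0 ≤ t →
        (hsHierarchyModel (d := d) hε hε' (N + 1)).seriesFamily (N + 1)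
            (fun k => bgsrMarginalFamily hε hε' N β ρ₀ k 0) s t =ᵐ[hsDomMeasure (d := d) ε s]
          bgsrMarginalFamily hε hε' N β ρ₀ s t)
    (hRob : 2 ≤ Fintype.card d → ∀ (N : ℕ) (ε : ℝ) (hε : 0 < ε) (hε' : ε < 2⁻¹),
      (hsHierarchyModel (d := d) hε hε' (N + 1)).RespectsAE (hsDomMeasure ε))
    (hReg : 2 ≤ Fintype.card d → ∀ ε : ℝ, 0 < ε → ε < 2⁻¹ → ∀ σ : ℝ,
      ∀ᵐ z : Config 1 d (UnitAddTorus d), ∀ n, bgsrRegular ε n 1 σ z) :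
    ∀ (_hd : 2 ≤ Fintype.card d) {β : ℝ} (_hβ : 0 < β) {A : ℝ} (_hA : 2 ≤ A) {R : ℝ} (_hR : 0 ≤ R),
      ∃ q : ℕ, ∃ κ₁ : ℝ, 0 < κ₁ ∧ ∃ c₁ : ℝ, 0 < c₁ ∧ ∃ c₂ : ℝ, 0 < c₂ ∧ ∃ C₁ : ℝ, ∃ N₁ : ℕ,
        ∀ N : ℕ, N₁ ≤ N → ∀ ε : ℝ, 0 < ε → ε < 2⁻¹ →
        1 < (N + 1 : ℝ) * ε ^ (Fintype.card d - 1) →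
        ∀ ρ₀ : UnitAddTorus d → ℝ, Continuous ρ₀ → (∀ x, 0 ≤ ρ₀ x) → (∀ x, ρ₀ x ≤ R) →
        ∫ x, ρ₀ x = 1 →
        ∀ Φ : HardSphereFlow (Literature.Analysis.FluidPDE.Torus.geometry d) ε (N + 1),
        ∀ t : ℝ, 1 < t → ∀ K : ℕ, 1 ≤ K → (K : ℝ) ≤ c₂ * Real.log (Real.log (N + 1)) →
        ∀ γ : ℝ, 0 < γ → γ ≤ 2⁻¹ →
        t * ((N + 1 : ℝ) * ε ^ (Fintype.card d - 1)) ≤ κ₁ * γ * K →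
        (t * ((N + 1 : ℝ) * ε ^ (Fintype.card d - 1))) ^ (A / (A - 1)) ≤ κ₁ * γ * K →
        t * ((N + 1 : ℝ) * ε ^ (Fintype.card d - 1)) ≤
          c₁ * Real.log (Real.log (N + 1)) ^ ((A - 1) / A) →
        ∀ᵐ z : UnitAddTorus d × EuclideanSpace ℝ d,
          |bgsrTaggedMarginal Φ β ρ₀ t z.1 z.2 - maxwellianBeta β z.2 *
              linearBoltzmannSeries (Literature.Analysis.FluidPDE.Torus.geometry d) β
                ((N + 1 : ℝ) * ε ^ (Fintype.card d - 1))
                (fun x _ => ρ₀ x) t z.1 z.2| ≤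
            C₁ * (γ ^ A + ε ^ (((Fintype.card d : ℝ) - 1) / ((q : ℝ) + 1)) *
              Real.exp (C₁ * Real.sqrt (Real.log (N + 1)) * Real.log (Real.log (N + 1)))) := by
  intro hd β hβ A hA R hR0
  /- ### constants depending on `d, β, A, R` only -/
  set n := Fintype.card d with hn
  have hn2 : 2 ≤ n := hd
  have hn2r : (2 : ℝ) ≤ (n : ℝ) := by exact_mod_cast hn2
  have hmC := maxwellianConst_pos (d := d) hβ
  set mC := maxwellianConst d β with hmCdef
  set C : ℝ := max 1 (4 * mC) with hCdef
  have hC1 : 1 ≤ C := le_max_left _ _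
  have hC0 : 0 < C := one_pos.trans_le hC1
  set Cd : ℝ := (∫ u : EuclideanSpace ℝ d, (1 + ‖u‖) * exp (-(1 / 2) * ‖u‖ ^ 2)) *
      (sphereMeasure (E := EuclideanSpace ℝ d)).real univ with hCd
  have hCd0 : 0 ≤ Cd := mul_nonneg (integral_nonneg fun u => by positivity) measureReal_nonneg
  set cβ : ℝ := 4 * sqrt 2 * Cd * sqrt 2 ^ n / sqrt β ^ (n + 1) with hcβ
  set cβ' : ℝ := 4 * sqrt 2 * Cd * sqrt 2 ^ n / sqrt (β / 2) ^ (n + 1) with hcβ'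
  have hcβ0 : 0 ≤ cβ := by positivity
  have hcβ'0 : 0 ≤ cβ' := by positivity
  set cP : ℝ := cβ + cβ' with hcP
  have hcP0 : 0 ≤ cP := add_nonneg hcβ0 hcβ'0
  set A₀ : ℕ := ⌈A⌉₊ with hA₀
  have hAA₀ : A ≤ (A₀ : ℝ) := Nat.le_ceil A
  have hA₀r : (2 : ℝ) ≤ (A₀ : ℝ) := hA.trans hAA₀
  have hA₀2 : 2 ≤ A₀ := by exact_mod_cast hA₀r
  have hA₀1 : 1 ≤ A₀ := by omega
  have hA₀0 : (0 : ℝ) < (A₀ : ℝ) := by linarith only [hA₀r]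
  have hlogA₀ : 1 / 2 ≤ Real.log A₀ := by
    have h1 := Real.one_sub_inv_le_log_of_pos hA₀0
    have h2 : (A₀ : ℝ)⁻¹ ≤ 2⁻¹ := inv_anti₀ two_pos hA₀r
    linarith only [h1, h2, show (2 : ℝ)⁻¹ = 1 / 2 by norm_num]
  have hlogA₀0 : 0 < Real.log A₀ := by linarith only [hlogA₀]
  have hlogA₀ne : Real.log A₀ ≠ 0 := hlogA₀0.ne'
  set κ₁ : ℝ := 1 / (exp 2 * C * (cP + 12)) with hκ₁
  have hκ₁0 : 0 < κ₁ := by positivity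
  set c₂ : ℝ := 1 / (2 * Real.log A₀) with hc₂
  have hc₂0 : 0 < c₂ := by positivity
  have hc₂1 : c₂ ≤ 1 := by rw [hc₂, div_le_one (by positivity)]; linarith only [hlogA₀]
  set cE : ℝ := sqrt (4 / β) with hcE
  have hcE0 : 0 ≤ cE := sqrt_nonneg _
  set V : ℝ := (volume (ball (0 : EuclideanSpace ℝ d) 1)).toReal with hV
  set cM : ℝ := 117 * n * (43 + 10 * cE) ^ (5 * n + 3) * V ^ 2 with hcM
  have hcM0 : 0 ≤ cM := by positivity
  set C₁ : ℝ := max (10 * n + 15 : ℝ) (max R 1 * C * (20 + 2 ^ (n + 1) + 48 * C * cP + 24 * cE * cM))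
    with hC₁
  have hC₁n : (10 * n + 15 : ℝ) ≤ C₁ := le_max_left _ _
  have hC₁0 : 0 ≤ C₁ := le_trans (by positivity) hC₁n
  set Emin : ℝ := sqrt (4 / β * Real.log 2) with hEmin
  have hEmin0 : 0 < Emin := Real.sqrt_pos.2 (mul_pos (by positivity) (Real.log_pos one_lt_two))
  set η₀ : ℝ := min (1 / 36) (min (1 / 2 ^ (n + 1)) Emin) with hη₀
  have hη₀0 : 0 < η₀ := lt_min (by norm_num) (lt_min (by positivity) hEmin0)
  have hη36 : η₀ ≤ 1 / 36 := min_le_left _ _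
  have hη2 : η₀ ≤ 1 / 2 ^ (n + 1) := (min_le_right _ _).trans (min_le_left _ _)
  have hηE : η₀ ≤ Emin := (min_le_right _ _).trans (min_le_right _ _)
  have hn1r : (0 : ℝ) < (n : ℝ) - 1 := by linarith only [hn2r]
  have hn1ne : (n : ℝ) - 1 ≠ 0 := hn1r.ne'
  set p : ℝ := 1 / (3 * ((n : ℝ) - 1)) with hp
  have hp0 : 0 < p := div_pos one_pos (by linarith only [hn1r])
  have hp1 : p ≤ 1 := by rw [hp, div_le_one (by linarith only [hn1r])]; linarith only [hn2r]
  obtain ⟨N₁, hN₁⟩ := exists_bgsr_threshold hη₀0 hp0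
  refine ⟨6 * n - 7, κ₁, hκ₁0, 1, one_pos, c₂, hc₂0, C₁, N₁, ?_⟩
  intro N hNN₁ ε hε hε' hα1 ρ₀ hρ₀c hρ₀0 hR hρ₀1 Φ t ht K hK hKc₂ γ hγ0 hγ hst _hst' hst1
  obtain ⟨hNe, hG⟩ := hN₁ N hNN₁
  /- ### the logarithms -/
  set Λ : ℝ := Real.log ((N : ℝ) + 1) with hΛ
  set LL : ℝ := Real.log Λ with hLL
  have hN0 : (0 : ℝ) < (N : ℝ) + 1 := by positivity
  have he1 : (1 : ℝ) ≤ exp 1 := by linarith only [Real.add_one_le_exp (1 : ℝ)]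
  have hΛe : exp 1 ≤ Λ := by
    rw [hΛ, ← Real.log_exp (exp 1)]
    exact Real.log_le_log (exp_pos _) hNe
  have hΛ1 : 1 ≤ Λ := he1.trans hΛe
  have hΛ0 : 0 < Λ := one_pos.trans_le hΛ1
  have hLL1 : 1 ≤ LL := by
    rw [hLL, ← Real.log_exp 1]
    exact Real.log_le_log (exp_pos 1) hΛe
  have hLL0 : 0 ≤ LL := zero_le_one.trans hLL1
  have hLLΛ : LL ≤ Λ := Real.log_le_self hΛ0.le
  have hsq1 : 1 ≤ sqrt Λ := by
    have h1 := Real.sqrt_le_sqrt hΛ1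
    rwa [Real.sqrt_one] at h1
  have hsq0 : 0 ≤ sqrt Λ := sqrt_nonneg _
  have hΛ2 : Λ ≤ Λ ^ 2 := le_self_pow₀ hΛ1 two_ne_zero
  have hsqΛ : sqrt Λ ≤ Λ := by
    have h2 := Real.sqrt_le_sqrt hΛ2
    rwa [Real.sqrt_sq hΛ0.le] at h2
  /- ### `α`, `t` -/
  set α : ℝ := ((N : ℝ) + 1) * ε ^ (n - 1) with hα
  have hα0 : 0 < α := by positivity
  have ht0 : 0 < t := one_pos.trans ht
  have htα : t * α ≤ LL := by
    have h1 : LL ^ ((A - 1) / A) ≤ LL :=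
      Real.rpow_le_self_of_one_le hLL1
        (by rw [div_le_one (by linarith only [hA])]; linarith only [hA])
    rw [one_mul] at hst1
    exact hst1.trans h1
  have hαLL : α ≤ LL := (le_mul_of_one_le_left hα0.le ht.le).trans htα
  have htLL : t ≤ LL := (le_mul_of_one_le_right ht0.le hα1.le).trans htα
  /- ### `s = ε^{1/6}` -/
  set s : ℝ := ε ^ (1 / 6 : ℝ) with hs
  have hs0 : 0 < s := Real.rpow_pos_of_pos hε _
  have hε1 : ε ≤ 1 := hε'.le.trans (by norm_num)
  have hs1 : s ≤ 1 := Real.rpow_le_one hε.le hε1 (by norm_num)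
  have hs6 : s ^ 6 = ε := by
    rw [hs, ← Real.rpow_mul_natCast hε.le]
    norm_num
  have hεs2 : ε ≤ s ^ 2 := by
    rw [← hs6]
    exact pow_le_pow_of_le_one hs0.le hs1 (by norm_num)
  have hs2s : s ^ 2 ≤ s := pow_le_of_le_one hs0.le hs1 (by norm_num)
  have hεs : ε ≤ s := hεs2.trans hs2s
  have hs2ε : s ^ 2 = (ε ^ (n - 1)) ^ p := by
    rw [hs, ← Real.rpow_mul_natCast hε.le, ← Real.rpow_natCast ε (n - 1), ← Real.rpow_mul hε.le, hp,
      Nat.cast_sub (by omega : 1 ≤ n)]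
    congr 1
    push_cast
    rw [mul_one_div, mul_comm (3 : ℝ), ← div_div, div_self hn1ne]
    norm_num
  /- ### smallness from the threshold -/
  set ν : ℝ := ((N : ℝ) + 1) ^ (-p) with hν
  have hν0 : 0 < ν := Real.rpow_pos_of_pos hN0 _
  have hG' : Λ ^ 2 * ν ≤ η₀ := hG
  have hs2 : s ^ 2 ≤ Λ * ν := by
    have h1 : ε ^ (n - 1) ≤ Λ / ((N : ℝ) + 1) := by
      rw [le_div_iff₀ hN0, mul_comm]
      exact hαLL.trans hLLΛ
    have h2 : (ε ^ (n - 1)) ^ p ≤ (Λ / ((N : ℝ) + 1)) ^ p := Real.rpow_le_rpow (by positivity) h1 hp0.le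
    have h3 : (Λ / ((N : ℝ) + 1)) ^ p = Λ ^ p * ν := by
      rw [Real.div_rpow hΛ0.le hN0.le, hν, Real.rpow_neg hN0.le, div_eq_mul_inv]
    have h4 : Λ ^ p ≤ Λ := Real.rpow_le_self_of_one_le hΛ1 hp1
    rw [hs2ε]
    calc (ε ^ (n - 1)) ^ p ≤ Λ ^ p * ν := h3 ▸ h2
      _ ≤ Λ * ν := mul_le_mul_of_nonneg_right h4 hν0.le
  have hsG : s ^ 2 ≤ η₀ := by
    calc s ^ 2 ≤ Λ * ν := hs2
      _ ≤ Λ ^ 2 * ν := mul_le_mul_of_nonneg_right hΛ2 hν0.le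
      _ ≤ η₀ := hG'
  have hsqG : sqrt Λ * s ^ 2 ≤ η₀ := by
    calc sqrt Λ * s ^ 2 ≤ Λ * (Λ * ν) := mul_le_mul hsqΛ hs2 (sq_nonneg _) hΛ0.le
      _ = Λ ^ 2 * ν := by ring
      _ ≤ η₀ := hG'
  have hLLG : LL * s ^ 2 ≤ η₀ := by
    calc LL * s ^ 2 ≤ Λ * (Λ * ν) := mul_le_mul hLLΛ hs2 (sq_nonneg _) hΛ0.le
      _ = Λ ^ 2 * ν := by ring
      _ ≤ η₀ := hG'
  /- ### the large quantity `X` -/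
  set X : ℝ := exp (sqrt Λ * LL) with hX
  have hX1 : 1 ≤ X := Real.one_le_exp (by positivity)
  have hsqX : sqrt Λ ≤ X := by
    calc sqrt Λ ≤ sqrt Λ * LL := le_mul_of_one_le_right hsq0 hLL1
      _ ≤ X := by rw [hX]; linarith only [Real.add_one_le_exp (sqrt Λ * LL)]
  have hΛX : Λ ≤ X := by
    calc Λ = exp LL := (Real.exp_log hΛ0).symm
      _ ≤ X := exp_le_exp.2 (le_mul_of_one_le_left hLL0 hsq1)
  have hLLX : LL ≤ X := hLLΛ.trans hΛX
  have hexpsqX : exp (sqrt Λ) ≤ X := exp_le_exp.2 (le_mul_of_one_le_right hsq0 hLL1)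
  have hαX : α ≤ X := hαLL.trans hLLX
  have htX : t ≤ X := htLL.trans hLLX
  /- ### `P = A₀^K` -/
  set P : ℝ := (A₀ : ℝ) ^ K with hP
  have hK1 : (1 : ℝ) ≤ K := by exact_mod_cast hK
  have hK0 : (0 : ℝ) < K := one_pos.trans_le hK1
  have hPsq : P ≤ sqrt Λ := by
    have h1 : (K : ℝ) * Real.log A₀ ≤ LL / 2 := by
      have h2 := mul_le_mul_of_nonneg_right hKc₂ hlogA₀0.le
      have h3 : c₂ * LL * Real.log A₀ = LL / 2 := by
        calc c₂ * LL * Real.log A₀ = LL / 2 * (Real.log A₀ / Real.log A₀) := by rw [hc₂]; ring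
          _ = LL / 2 := by rw [div_self hlogA₀ne, mul_one]
      linarith only [h2, h3]
    have h2 : P = exp ((K : ℝ) * Real.log A₀) := by
      rw [hP, ← Real.rpow_natCast, Real.rpow_def_of_pos hA₀0, mul_comm]
    rw [h2, Real.sqrt_eq_rpow, Real.rpow_def_of_pos hΛ0]
    refine exp_le_exp.2 ?_
    rw [← hLL]
    linarith only [h1]
  have hPX : P ≤ X := hPsq.trans hsqX
  have hexpP : exp P ≤ X := (exp_le_exp.2 hPsq).trans hexpsqX
  /- ### `L = n_K` -/
  set L : ℕ := pruneLevel A₀ K with hL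
  have hL2P : (L : ℝ) ≤ 2 * P := by
    obtain ⟨K', hK'⟩ : ∃ K', K = K' + 1 := ⟨K - 1, by omega⟩
    have h1 := pruneLevel_succ_le hA₀2 K'
    rw [← hK'] at h1
    have h2 : ((pruneLevel A₀ K : ℕ) : ℝ) ≤ ((2 * A₀ ^ K : ℕ) : ℝ) := by exact_mod_cast h1
    push_cast at h2
    exact h2
  have hL2X : (L : ℝ) ≤ 2 * X := hL2P.trans (by linarith only [hPX])
  have hLN : L ≤ N + 1 := by
    have h1 : (L : ℝ) ≤ 2 * sqrt Λ := hL2P.trans (by linarith only [hPsq])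
    have h2 : 2 * sqrt Λ ≤ Λ + 1 := by
      nlinarith only [Real.sq_sqrt hΛ0.le, sq_nonneg (sqrt Λ - 1)]
    have h3 : Λ ≤ (N : ℝ) := by
      have h4 := Real.log_le_sub_one_of_pos hN0
      rw [← hΛ] at h4
      linarith only [h4]
    have h4 : (L : ℝ) ≤ (N : ℝ) + 1 := by linarith only [h1, h2, h3]
    exact_mod_cast h4
  /- ### the step `h = t/K` and the smallness `α h ≤ κ₁ γ` -/
  have hKne : (K : ℝ) ≠ 0 := hK0.ne'
  set h : ℝ := t / K with hh
  have hKh : (K : ℝ) * h = t := by rw [hh]; field_simp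
  have hh0 : 0 < h := div_pos ht0 hK0
  have hu : α * h ≤ κ₁ * γ := by
    have h1 : α * h = t * α / K := by rw [hh]; ring
    rw [h1, div_le_iff₀ hK0]
    exact hst
  have hγ1 : γ ≤ 1 := hγ.trans (by norm_num)
  have hCcP : C * (cP + 12) ≠ 0 := by positivity
  have hcu : ∀ {c : ℝ}, 0 ≤ c → c ≤ cP + 12 → C * (c * α) * h ≤ γ / exp 2 := by
    intro c hc0 hcle
    calc C * (c * α) * h = C * c * (α * h) := by ring
      _ ≤ C * (cP + 12) * (κ₁ * γ) :=
          mul_le_mul (mul_le_mul_of_nonneg_left hcle hC0.le) hu (mul_nonneg hα0.le hh0.le) (by positivity)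
      _ = γ / exp 2 := by
          rw [hκ₁]
          field_simp
  have hγe : γ / exp 2 ≤ 1 := by
    rw [div_le_one (exp_pos 2)]
    exact hγ1.trans (by linarith only [Real.add_one_le_exp (2 : ℝ)])
  /- ### `δ = s² ≤ h` and `N (2ε)^d ≤ 1/2` -/
  have hδh : s ^ 2 ≤ h := by
    rw [hh, le_div_iff₀ hK0]
    have h1 : s ^ 2 * K ≤ s ^ 2 * (c₂ * LL) := mul_le_mul_of_nonneg_left hKc₂ (sq_nonneg _)
    have h3 : s ^ 2 * (c₂ * LL) ≤ LL * s ^ 2 := by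
      calc s ^ 2 * (c₂ * LL) ≤ s ^ 2 * (1 * LL) :=
            mul_le_mul_of_nonneg_left (mul_le_mul_of_nonneg_right hc₂1 hLL0) (sq_nonneg _)
        _ = LL * s ^ 2 := by ring
    linarith only [h1, h3, hLLG, hη36, ht]
  have hN2 : (N : ℝ) * (2 * ε) ^ n ≤ 2⁻¹ := by
    have h1 : (N : ℝ) * (2 * ε) ^ n ≤ ((N : ℝ) + 1) * (2 * ε) ^ n :=
      mul_le_mul_of_nonneg_right (by linarith only) (by positivity)
    have h2 : ((N : ℝ) + 1) * (2 * ε) ^ n = 2 ^ n * (α * ε) := by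
      have h3 : (2 * ε) ^ n = 2 ^ n * (ε ^ (n - 1) * ε) := by
        rw [mul_pow, ← pow_succ, Nat.sub_add_cancel (by omega : 1 ≤ n)]
      rw [h3, hα]
      ring
    have h3 : α * ε ≤ LL * s ^ 2 := mul_le_mul hαLL hεs2 hε.le hLL0
    have h4 : (2 : ℝ) ^ n * (α * ε) ≤ 2 ^ n * η₀ := mul_le_mul_of_nonneg_left (h3.trans hLLG) (by positivity)
    have h5 : (2 : ℝ) ^ n * η₀ ≤ 2⁻¹ := by
      calc (2 : ℝ) ^ n * η₀ ≤ 2 ^ n * (1 / 2 ^ (n + 1)) := mul_le_mul_of_nonneg_left hη2 (by positivity)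
        _ = 2⁻¹ := by
            rw [pow_succ]
            field_simp
    linarith only [h1, h2, h4, h5]
  /- ### the energy cut-off `E` -/
  have hlogε : Real.log ε < 0 := Real.log_neg hε (by linarith only [hε1, hε'])
  have hnegl : -Real.log ε ≤ Λ := by
    have h1 : 0 < Real.log α := Real.log_pos hα1
    rw [hα, Real.log_mul hN0.ne' (pow_pos hε _).ne', Real.log_pow] at h1
    have h2 : ((n - 1 : ℕ) : ℝ) * Real.log ε ≤ Real.log ε := by
      have h3 : (1 : ℝ) ≤ ((n - 1 : ℕ) : ℝ) := by exact_mod_cast (show 1 ≤ n - 1 by omega)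
      exact mul_le_of_one_le_left hlogε.le h3
    rw [← hΛ] at h1
    linarith only [h1, h2]
  have h4β : 0 < 4 / β := by positivity
  set E : ℝ := sqrt (-(4 / β * Real.log ε)) with hE
  have hE2' : 0 < -(4 / β * Real.log ε) := by
    rw [neg_mul_eq_mul_neg]
    exact mul_pos h4β (by linarith only [hlogε])
  have hE2 : E ^ 2 = -(4 / β * Real.log ε) := Real.sq_sqrt hE2'.le
  have hE0 : 0 < E := Real.sqrt_pos.2 hE2'
  have hEs : exp (-(β * E ^ 2 / 4)) ≤ s := by
    have h1 : -(β * E ^ 2 / 4) = Real.log ε := by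
      rw [hE2]
      field_simp
    rw [h1, Real.exp_log hε]
    exact hεs
  have hEX : E ≤ cE * X := by
    have h1 : E ≤ sqrt (4 / β * Λ) :=
      Real.sqrt_le_sqrt (by rw [neg_mul_eq_mul_neg]; exact mul_le_mul_of_nonneg_left hnegl h4β.le)
    have h2 : sqrt (4 / β * Λ) = cE * sqrt Λ := by rw [hcE, Real.sqrt_mul h4β.le]
    rw [h2] at h1
    exact h1.trans (mul_le_mul_of_nonneg_left hsqX hcE0)
  have hEminE : Emin ≤ E := by
    refine Real.sqrt_le_sqrt ?_
    have h1 : Real.log 2 ≤ -Real.log ε := by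
      rw [← Real.log_inv]
      exact Real.log_le_log two_pos ((le_inv_comm₀ two_pos hε).2 hε'.le)
    rw [neg_mul_eq_mul_neg]
    exact mul_le_mul_of_nonneg_left h1 h4β.le
  /- ### the tuning `ā = 3√Λ ε`, `ε₀ = s⁴`, `δ = s²`, `λ = s` -/
  set a₀ : ℝ := 3 * sqrt Λ with ha₀
  have ha₀1 : 1 ≤ a₀ := by linarith only [hsq1, ha₀]
  have ha₀0 : 0 ≤ a₀ := zero_le_one.trans ha₀1
  have h12 : 12 * a₀ * s ^ 2 ≤ 1 := by
    calc 12 * a₀ * s ^ 2 = 36 * (sqrt Λ * s ^ 2) := by rw [ha₀]; ring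
      _ ≤ 1 := by linarith only [hsqG, hη36]
  have hε₀ : s ^ 4 ≤ 1 / 12 := by
    have h1 : s ^ 4 ≤ s ^ 2 := pow_le_pow_of_le_one hs0.le hs1 (by norm_num)
    linarith only [h1, hsG, hη36]
  have hδE : s ^ 2 ≤ E := (hsG.trans hηE).trans hEminE
  have hāε₀ : 4 * (a₀ * s ^ 6) ≤ s ^ 4 := by
    have h1 : 4 * a₀ * s ^ 2 ≤ 1 := by
      have h2 : 0 ≤ a₀ * s ^ 2 := mul_nonneg ha₀0 (sq_nonneg _)
      linarith only [h12, h2]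
    calc 4 * (a₀ * s ^ 6) = (4 * a₀ * s ^ 2) * s ^ 4 := by ring
      _ ≤ 1 * s ^ 4 := mul_le_mul_of_nonneg_right h1 (by positivity)
      _ = s ^ 4 := one_mul _
  have hLε : ((L : ℝ) + 1) * ε ≤ a₀ * s ^ 6 := by
    rw [hs6]
    refine mul_le_mul_of_nonneg_right ?_ hε.le
    linarith only [hL2P, hPsq, hsq1, ha₀]
  /- ### the bad-set bound `mBad` -/
  set B : ℝ := 36 + (L : ℝ) + 4 * E + (6 * (t * E) + 2) + a₀ with hB
  set mBad : ℝ := s * (117 * n * B ^ (5 * n + 3)) * V ^ 2 with hmBad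
  have hB0 : 0 ≤ B := by positivity
  have hmBad0 : 0 ≤ mBad := by positivity
  have hBX : B ≤ (43 + 10 * cE) * X ^ 2 := by
    have hX2 : X ≤ X ^ 2 := le_self_pow₀ hX1 two_ne_zero
    have h1 : (L : ℝ) ≤ 2 * X ^ 2 := hL2X.trans (by linarith only [hX2])
    have h2 : E ≤ cE * X ^ 2 := hEX.trans (mul_le_mul_of_nonneg_left hX2 hcE0)
    have h3 : t * E ≤ X * (cE * X) := mul_le_mul htX hEX hE0.le (zero_le_one.trans hX1)
    have h4 : a₀ ≤ 3 * X ^ 2 := by rw [ha₀]; linarith only [hsqX, hX2]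
    have h5 : (38 : ℝ) ≤ 38 * X ^ 2 := by linarith only [hX1, hX2]
    calc B = 36 + L + 4 * E + (6 * (t * E) + 2) + a₀ := rfl
      _ ≤ 36 * X ^ 2 + 2 * X ^ 2 + 4 * (cE * X ^ 2) + (6 * (X * (cE * X)) + 2 * X ^ 2) + 3 * X ^ 2 := by
          linarith only [h1, h2, h3, h4, h5]
      _ = (43 + 10 * cE) * X ^ 2 := by ring
  have hmBadX : mBad ≤ s * (cM * X ^ (10 * n + 6)) := by
    have h1 : B ^ (5 * n + 3) ≤ ((43 + 10 * cE) * X ^ 2) ^ (5 * n + 3) := pow_le_pow_left₀ hB0 hBX _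
    have h2 : ((43 + 10 * cE) * X ^ 2) ^ (5 * n + 3) = (43 + 10 * cE) ^ (5 * n + 3) * X ^ (10 * n + 6) := by
      rw [mul_pow, ← pow_mul]
      congr 1
      ring_nf
    calc mBad = s * (117 * n * B ^ (5 * n + 3) * V ^ 2) := by rw [hmBad]; ring
      _ ≤ s * (117 * n * ((43 + 10 * cE) * X ^ 2) ^ (5 * n + 3) * V ^ 2) := by gcongr
      _ = s * (cM * X ^ (10 * n + 6)) := by rw [h2, hcM]; ring
  have hmBadH : ∀ k ≤ pruneLevel A₀ K, ∀ (Y : Config k d (UnitAddTorus d)) (m : Fin k) (σ' : ℝ), 0 ≤ σ' →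
      Y ∈ bgsrGoodConfigs (Literature.Analysis.FluidPDE.Torus.geometry d) k (s ^ 4) σ' →
      ((sphereMeasure (E := EuclideanSpace ℝ d)).prod (volume : Measure (EuclideanSpace ℝ d)))
          {q : sphere (0 : EuclideanSpace ℝ d) 1 × EuclideanSpace ℝ d |
            ‖q.2‖ ≤ E ∧ ((q.1 : EuclideanSpace ℝ d), q.2) ∈
              bgsrBadSet (K * h) (a₀ * s ^ 6) (s ^ 4) (s ^ 2) (3 * E) Y m} ≤
        ENNReal.ofReal mBad := by
    intro k hk Y m σ' hσ' hY
    have hsep : ∀ j : Fin k, j ≠ m → s ^ 4 ≤ euclidDist (Y m).1 (Y j).1 := fun j hj =>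
      euclidDist_ge_of_mem_bgsrGoodConfigs hσ' hY (Ne.symm hj)
    refine (sphereMeasure_prod_bgsrBadSet_le_of_tuning hd hs0 hs1 (t := K * h) (by positivity) hE0 ha₀1
      h12 hε₀ hδE hsep).trans (ENNReal.ofReal_le_ofReal ?_)
    rw [hKh, ← hn, ← hV]
    have hk' : (k : ℝ) ≤ L := by exact_mod_cast hk
    have hBk : 36 + (k : ℝ) + 4 * E + (6 * (t * E) + 2) + a₀ ≤ B := by rw [hB]; linarith only [hk']
    have hBk0 : 0 ≤ 36 + (k : ℝ) + 4 * E + (6 * (t * E) + 2) + a₀ := by positivity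
    rw [hmBad]
    gcongr
  /- ### the two models and their pruning constants -/
  set M₁ := hsHierarchyModel (d := d) hε hε' (N + 1) with hM₁
  set M₂ := boltzmannModel (Literature.Analysis.FluidPDE.Torus.geometry d) measurable_translate_torus α
    with hM₂
  have hpc₁ : M₁.pruneConst β = cβ * α := by
    rw [hM₁, pruneConst_hsHierarchyModel, hcβ, hα]
    push_cast
    rfl
  have hpc₁' : M₁.pruneConst (β / 2) = cβ' * α := by
    rw [hM₁, pruneConst_hsHierarchyModel, hcβ', hα]
    push_cast
    rfl
  have hopc : M₁.opConst = M₂.opConst := by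
    show (((N + 1 : ℕ) : ℝ) * ε ^ (Fintype.card d - 1)) *
        ((∫ u : EuclideanSpace ℝ d, (1 + ‖u‖) * exp (-(1 / 2) * ‖u‖ ^ 2)) *
          (sphereMeasure (E := EuclideanSpace ℝ d)).real univ) =
      |α| * ((∫ u : EuclideanSpace ℝ d, (1 + ‖u‖) * exp (-(1 / 2) * ‖u‖ ^ 2)) *
          (sphereMeasure (E := EuclideanSpace ℝ d)).real univ)
    rw [abs_of_nonneg hα0.le, hα]
    push_cast
    rfl
  have hpc : ∀ b', M₂.pruneConst b' = M₁.pruneConst b' := fun b' => by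
    simp only [HierarchyModel.pruneConst, hopc]
  have hcβP : cβ ≤ cP + 12 := by linarith only [hcP, hcβ'0]
  have hcβ'P : cβ' ≤ cP + 12 := by linarith only [hcP, hcβ0]
  have hsmall : max 1 (2 * mC) * M₁.pruneConst β * h ≤ γ / exp 2 := by
    rw [hpc₁]
    have h1 : max 1 (2 * mC) ≤ C := max_le_max le_rfl (by linarith only [hmC])
    calc max 1 (2 * mC) * (cβ * α) * h ≤ C * (cβ * α) * h :=
          mul_le_mul_of_nonneg_right (mul_le_mul_of_nonneg_right h1 (mul_nonneg hcβ0 hα0.le)) hh0.le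
      _ ≤ γ / exp 2 := hcu hcβ0 hcβP
  have hu₁ : C * M₁.pruneConst β * h ≤ 1 := by
    rw [hpc₁]; exact (hcu hcβ0 hcβP).trans hγe
  have hu₁' : C * M₁.pruneConst (β / 2) * h ≤ 1 := by
    rw [hpc₁']; exact (hcu hcβ'0 hcβ'P).trans hγe
  have hu₂ : C * M₂.pruneConst β * h ≤ 1 := by rw [hpc]; exact hu₁
  have hu₂' : C * M₂.pruneConst (β / 2) * h ≤ 1 := by rw [hpc]; exact hu₁'
  have hu₃ : (6 * M₂.pruneConst β + 12 * α) * C * h ≤ 6 := by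
    rw [hpc, hpc₁]
    have h1 := (hcu (c := cβ + 2) (by linarith only [hcβ0]) (by linarith only [hcP, hcβ'0])).trans hγe
    calc (6 * (cβ * α) + 12 * α) * C * h = 6 * (C * ((cβ + 2) * α) * h) := by ring
      _ ≤ 6 * 1 := by linarith only [h1]
      _ = 6 := by norm_num
  have hcR₁X : M₁.pruneConst β ≤ cP * X := by
    rw [hpc₁]
    exact mul_le_mul (by linarith only [hcP, hcβ'0]) hαX hα0.le hcP0
  have hcR₂X : M₂.pruneConst β ≤ cP * X := by rw [hpc]; exact hcR₁X
  /- ### `γ^{⌈A⌉} ≤ γ^A` -/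
  have hγA : γ ^ A₀ ≤ γ ^ A := by
    rw [← Real.rpow_natCast γ A₀]
    exact Real.rpow_le_rpow_of_exponent_ge hγ0 hγ1 hAA₀
  /- ### the assembled comparison at time `K h = t` -/
  have hmain := ae_abs_bgsrMarginalFamily_sub_bgsrHierarchyFamily_le_dom hε hε' N hβ hρ₀c hρ₀0 hR hN2 hα
    (fun s' hs' t' ht' => hS hd N ε hε hε' hN2 β hβ R ρ₀ hρ₀c hρ₀0 hR hρ₀1 s' hs' t' ht'.1) (hRob hd N ε hε hε')
    hA₀2 hK (pow_pos hs0 2) hδh hKh.le hγ0.le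
    (hγ.trans_eq (by norm_num)) hsmall hE0.le hāε₀ hLε hLN hmBad0 hmBadH (hReg hd ε hε hε' (K * h))
  rw [hKh] at hmain
  have hbook := bgsr_final_bookkeeping (N := N) (γA := γ ^ A) hn2 hA₀1 hR0 hmC.le hX1 hs0.le hs1 hγ0.le
    hγA hEs hE0.le hcE0 hEX hPX hexpP (sq_nonneg s) hs2s hh0.le (M₁.pruneConst_nonneg β)
    (M₁.pruneConst_nonneg (β / 2)) (M₂.pruneConst_nonneg β) (M₂.pruneConst_nonneg (β / 2)) hcP0
    hcR₁X hcR₂X hu₁ hu₁' hu₂ hu₂' hu₃ hα1 hαX hε hεs hα.symm hL2X hmBad0 hcM0 hmBadX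
  /- ### the final shape of the bound -/
  have hexpo : ((n : ℝ) - 1) / (((6 * n - 7 : ℕ) : ℝ) + 1) = 1 / 6 := by
    have h1 : (((6 * n - 7 : ℕ) : ℝ) + 1) = ((n : ℝ) - 1) * 6 := by
      rw [Nat.cast_sub (by omega), Nat.cast_mul]
      push_cast
      ring
    rw [h1, ← div_div, div_self hn1ne]
  have htail : s * X ^ (10 * n + 15) ≤
      ε ^ (((n : ℝ) - 1) / (((6 * n - 7 : ℕ) : ℝ) + 1)) * exp (C₁ * sqrt Λ * LL) := by
    rw [hexpo, ← hs]
    refine mul_le_mul_of_nonneg_left ?_ hs0.le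
    rw [hX, ← Real.exp_nat_mul]
    refine exp_le_exp.2 ?_
    push_cast
    have h0 : 0 ≤ sqrt Λ * LL := by positivity
    calc (10 * (n : ℝ) + 15) * (sqrt Λ * LL) ≤ C₁ * (sqrt Λ * LL) := mul_le_mul_of_nonneg_right hC₁n h0
      _ = C₁ * sqrt Λ * LL := by ring
  have hfin : ∀ᵐ Z : Config 1 d (UnitAddTorus d),
      |bgsrMarginalFamily (d := d) hε hε' N β ρ₀ 1 t (fun _ => Z 0) -
          bgsrHierarchyFamily β
            (linearBoltzmannSeries (Literature.Analysis.FluidPDE.Torus.geometry d) β α fun x _ => ρ₀ x) 1 t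
            (fun _ => Z 0)| ≤
        C₁ * (γ ^ A + ε ^ (((n : ℝ) - 1) / (((6 * n - 7 : ℕ) : ℝ) + 1)) * exp (C₁ * sqrt Λ * LL)) := by
    filter_upwards [hmain] with Z hZ
    rw [config_one_eq_const Z] at hZ
    exact hZ.trans (hbook.trans (mul_le_mul_of_nonneg_left (add_le_add le_rfl htail) hC₁0))
  have hfin' := ae_prod_of_ae_config_one
    (P := fun z => |bgsrMarginalFamily (d := d) hε hε' N β ρ₀ 1 t (fun _ => z) -
          bgsrHierarchyFamily β
            (linearBoltzmannSeries (Literature.Analysis.FluidPDE.Torus.geometry d) β α fun x _ => ρ₀ x) 1 t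
            (fun _ => z)| ≤
        C₁ * (γ ^ A + ε ^ (((n : ℝ) - 1) / (((6 * n - 7 : ℕ) : ℝ) + 1)) * exp (C₁ * sqrt Λ * LL))) hfin
  filter_upwards [hfin', bgsrTaggedMarginal_ae_eq_bgsrMarginalFamily hε hε' N β ρ₀ Φ t] with z hz hz'
  rw [hz', mul_comm (maxwellianBeta β z.2),
    ← bgsrHierarchyFamily_one_const β
      (linearBoltzmannSeries (Literature.Analysis.FluidPDE.Torus.geometry d) β α fun x _ => ρ₀ x) t z]
  exact hz

/-- **The pruned comparison (H) from the three inputs in their first-stated form** (kept, with its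
statement, for its users; the input `hRob` in this form is not satisfiable for the hard-sphere
model — see `TaggedSphereDomainInputs` — and the theorem to use is
`bgsr_prunedComparison_of_domInputs` / `bgsr_linearBoltzmannApprox_of_domainInputs`): a corollary
of `bgsr_prunedComparison_of_domInputs` (`seriesFamily_ae_eq_bgsrMarginalFamily_dom_of_ae`,
`respectsAE_hsDomMeasure_of_volume`).
[cite: BodineauGallagherSaintRaymondInvent2016, §5.3.4 Prop. 5.8 and proof of Thm 2.2, p. 21] -/
theorem bgsr_prunedComparison_of_inputs [DecidableEq d]
    (hS : ∀ (N : ℕ) (ε : ℝ) (hε : 0 < ε) (hε' : ε < 2⁻¹) (β : ℝ) (ρ₀ : UnitAddTorus d → ℝ) (T : ℝ),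
      ∀ s ≤ N + 1, ∀ t ∈ Icc 0 T,
        (hsHierarchyModel (d := d) hε hε' (N + 1)).seriesFamily (N + 1)
            (fun k => bgsrMarginalFamily hε hε' N β ρ₀ k 0) s t =ᵐ[volume]
          bgsrMarginalFamily hε hε' N β ρ₀ s t)
    (hRob : ∀ (N : ℕ) (ε : ℝ) (hε : 0 < ε) (hε' : ε < 2⁻¹),
      (hsHierarchyModel (d := d) hε hε' (N + 1)).RespectsAE (fun _ => volume))
    (hReg : ∀ (ε σ : ℝ), ∀ᵐ z : Config 1 d (UnitAddTorus d), ∀ n, bgsrRegular ε n 1 σ z) :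
    ∀ (_hd : 2 ≤ Fintype.card d) {β : ℝ} (_hβ : 0 < β) {A : ℝ} (_hA : 2 ≤ A) {R : ℝ} (_hR : 0 ≤ R),
      ∃ q : ℕ, ∃ κ₁ : ℝ, 0 < κ₁ ∧ ∃ c₁ : ℝ, 0 < c₁ ∧ ∃ c₂ : ℝ, 0 < c₂ ∧ ∃ C₁ : ℝ, ∃ N₁ : ℕ,
        ∀ N : ℕ, N₁ ≤ N → ∀ ε : ℝ, 0 < ε → ε < 2⁻¹ →
        1 < (N + 1 : ℝ) * ε ^ (Fintype.card d - 1) →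
        ∀ ρ₀ : UnitAddTorus d → ℝ, Continuous ρ₀ → (∀ x, 0 ≤ ρ₀ x) → (∀ x, ρ₀ x ≤ R) →
        ∫ x, ρ₀ x = 1 →
        ∀ Φ : HardSphereFlow (Literature.Analysis.FluidPDE.Torus.geometry d) ε (N + 1),
        ∀ t : ℝ, 1 < t → ∀ K : ℕ, 1 ≤ K → (K : ℝ) ≤ c₂ * Real.log (Real.log (N + 1)) →
        ∀ γ : ℝ, 0 < γ → γ ≤ 2⁻¹ →
        t * ((N + 1 : ℝ) * ε ^ (Fintype.card d - 1)) ≤ κ₁ * γ * K →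
        (t * ((N + 1 : ℝ) * ε ^ (Fintype.card d - 1))) ^ (A / (A - 1)) ≤ κ₁ * γ * K →
        t * ((N + 1 : ℝ) * ε ^ (Fintype.card d - 1)) ≤
          c₁ * Real.log (Real.log (N + 1)) ^ ((A - 1) / A) →
        ∀ᵐ z : UnitAddTorus d × EuclideanSpace ℝ d,
          |bgsrTaggedMarginal Φ β ρ₀ t z.1 z.2 - maxwellianBeta β z.2 *
              linearBoltzmannSeries (Literature.Analysis.FluidPDE.Torus.geometry d) β
                ((N + 1 : ℝ) * ε ^ (Fintype.card d - 1))
                (fun x _ => ρ₀ x) t z.1 z.2| ≤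
            C₁ * (γ ^ A + ε ^ (((Fintype.card d : ℝ) - 1) / ((q : ℝ) + 1)) *
              Real.exp (C₁ * Real.sqrt (Real.log (N + 1)) * Real.log (Real.log (N + 1)))) :=
  bgsr_prunedComparison_of_domInputs
    (fun _ N ε hε hε' _ β _ _ ρ₀ _ _ _ _ s hs t ht =>
      seriesFamily_ae_eq_bgsrMarginalFamily_dom_of_ae hε hε' N β ρ₀ (hS N ε hε hε' β ρ₀ t s hs t ⟨ht, le_rfl⟩))
    (fun _ N ε hε hε' => respectsAE_hsDomMeasure_of_volume hε hε' (N + 1) (hRob N ε hε hε'))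
    (fun _ ε _ _ σ => hReg ε σ)

/-- **BGSR Theorem 2.2 (2.9) from the three inputs (S), (R), (Reg).** Under (S) the iterated
Duhamel formula up to null sets for the BBGKY marginals along the regularised hard-sphere flows,
(R) the Duhamel terms of the hard-sphere models respect null sets, and (Reg) almost-sure regularity
of one-particle configurations to all depths, the named fact `bgsr_linearBoltzmannApprox`
(`TaggedSphereDiffusion`; BGSR Thm 2.2 (2.9)) holds: `bgsr_prunedComparison_of_inputs` fed to the
glue `bgsr_linearBoltzmannApprox_of_prunedComparison_pow` (`TaggedSphereLinearBoltzmannRate`).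
[cite: BodineauGallagherSaintRaymondInvent2016, Thm 2.2 (2.9), p. 7; proof §5.3.4, p. 21] -/
theorem bgsr_linearBoltzmannApprox_of_inputs [DecidableEq d]
    (hS : ∀ (N : ℕ) (ε : ℝ) (hε : 0 < ε) (hε' : ε < 2⁻¹) (β : ℝ) (ρ₀ : UnitAddTorus d → ℝ) (T : ℝ),
      ∀ s ≤ N + 1, ∀ t ∈ Icc 0 T,
        (hsHierarchyModel (d := d) hε hε' (N + 1)).seriesFamily (N + 1)
            (fun k => bgsrMarginalFamily hε hε' N β ρ₀ k 0) s t =ᵐ[volume]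
          bgsrMarginalFamily hε hε' N β ρ₀ s t)
    (hRob : ∀ (N : ℕ) (ε : ℝ) (hε : 0 < ε) (hε' : ε < 2⁻¹),
      (hsHierarchyModel (d := d) hε hε' (N + 1)).RespectsAE (fun _ => volume))
    (hReg : ∀ (ε σ : ℝ), ∀ᵐ z : Config 1 d (UnitAddTorus d), ∀ n, bgsrRegular ε n 1 σ z) :
    bgsr_linearBoltzmannApprox (d := d) :=
  bgsr_linearBoltzmannApprox_of_prunedComparison_pow (bgsr_prunedComparison_of_inputs hS hRob hReg)

/-- **BGSR Theorem 2.2 (2.9) from the three inputs (S), (R), (Reg) in their corrected, provable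
form** — the theorem to use; each input is only asked in dimension `d ≥ 2` (the binder
`2 ≤ Fintype.card d`, under which the fact's conclusion is stated). (S): for `0 < ε < 1/2` in the
regime `N(2ε)^d ≤ 1/2`, `β > 0` and a
continuous probability density `0 ≤ ρ⁰ ≤ R` on `T^d`, the finite Duhamel series of the initial
marginals of BGSR's transported datum along the regularised `(N+1)`-sphere flows agrees
Lebesgue-a.e., at every level `s ≤ N + 1` and time `t ≥ 0`, with the marginal at time `t` (the
iterated Duhamel formula up to null sets: BGSR §3.1 with Remark 3.1; Spohn 2006 Thm 11 / Cor. 12;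
Simonella 2014). (R): the Duhamel terms of the hard-sphere models respect Lebesgue-null sets on
nice families SUPPORTED IN THE HARD-SPHERE DOMAINS (`HierarchyModel.RespectsAEOn` of
`HierarchyDuhamelSeriesOn` with the Lebesgue measures and the hard-sphere domains; the
non-singularity of the parametrisation of the pseudo-trajectories, BGSR p. 15 after Simonella
2014; the unrestricted form is false, `TaggedSphereDomainInputs`). (Reg): for `0 < ε < 1/2` and every horizon, almost every
one-particle configuration is regular to all depths (`bgsrRegular`, `PseudoTrajectoryCoupling`;
the flux form of Alexander's theorem, BGSR p. 15). Proof: `bgsr_prunedComparison_of_domInputs`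
(via `seriesFamily_ae_eq_bgsrMarginalFamily_dom_of_ae`, `respectsAE_hsDomMeasure_of_domain`) fed
to the glue `bgsr_linearBoltzmannApprox_of_prunedComparison_pow` (`TaggedSphereLinearBoltzmannRate`).
[cite: BodineauGallagherSaintRaymondInvent2016, Thm 2.2 (2.9), p. 7; proof §5.3.4, p. 21] -/
theorem bgsr_linearBoltzmannApprox_of_domainInputs [DecidableEq d]
    (hS : 2 ≤ Fintype.card d → ∀ (N : ℕ) (ε : ℝ) (hε : 0 < ε) (hε' : ε < 2⁻¹),
      (N : ℝ) * (2 * ε) ^ Fintype.card d ≤ 2⁻¹ →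
      ∀ (β : ℝ), 0 < β → ∀ (R : ℝ) (ρ₀ : UnitAddTorus d → ℝ), Continuous ρ₀ → (∀ x, 0 ≤ ρ₀ x) →
      (∀ x, ρ₀ x ≤ R) → ∫ x, ρ₀ x = 1 → ∀ s ≤ N + 1, ∀ t : ℝ, 0 ≤ t →
        (hsHierarchyModel (d := d) hε hε' (N + 1)).seriesFamily (N + 1)
            (fun k => bgsrMarginalFamily hε hε' N β ρ₀ k 0) s t =ᵐ[volume]
          bgsrMarginalFamily hε hε' N β ρ₀ s t)
    (hRob : 2 ≤ Fintype.card d → ∀ (Ntot : ℕ) (ε : ℝ) (hε : 0 < ε) (hε' : ε < 2⁻¹),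
      (hsHierarchyModel (d := d) hε hε' Ntot).RespectsAEOn (fun _ => volume)
        (fun k => hardSphereDomain (Literature.Analysis.FluidPDE.Torus.geometry d) k ε))
    (hReg : 2 ≤ Fintype.card d → ∀ ε : ℝ, 0 < ε → ε < 2⁻¹ → ∀ σ : ℝ,
      ∀ᵐ z : Config 1 d (UnitAddTorus d), ∀ n, bgsrRegular ε n 1 σ z) :
    bgsr_linearBoltzmannApprox (d := d) :=
  bgsr_linearBoltzmannApprox_of_prunedComparison_pow
    (bgsr_prunedComparison_of_domInputs
      (fun hd N ε hε hε' hN β hβ R ρ₀ hc h0 hR h1 s hs t ht =>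
        seriesFamily_ae_eq_bgsrMarginalFamily_dom_of_ae hε hε' N β ρ₀
          (hS hd N ε hε hε' hN β hβ R ρ₀ hc h0 hR h1 s hs t ht))
      (fun hd N ε hε hε' => respectsAE_hsDomMeasure_of_domain hε hε' (N + 1)
        (fun n s _ hh _ _ h₁ h₂ v₁ v₂ hae => hRob hd (N + 1) ε hε hε' n s hh h₁ h₂ v₁ v₂ hae))
      hReg)

end Kinetic

end

end Literature.MathematicalPhysics.KineticTheory
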